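import Mathlib
import HarnessLib
import Summits.HubbardSuperconductivity.HubbardSuperconductivity.Theorems.ComplexGFFStiffnessDefs
import Summits.HubbardSuperconductivity.HubbardSuperconductivity.Theorems.ComplexGFFStiffnessHypACumulantGaussRep
import Literature.MathematicalPhysics.StatisticalMechanics.WeightTowerFactorisation
import Literature.MathematicalPhysics.StatisticalMechanics.WeightTowerStrong
import Literature.MathematicalPhysics.StatisticalMechanics.TorusFiniteRangeDecomposition

/-!
# Line `gnv`, stub `stub_gnvOfFrd`: the seed of the weight tower and the finite-range separation
# (instantiating `GradientRG.WeightData` hypotheses for the model; ABKM19 (7.5), (7.58), (12.13))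

The abstract weight tower `Literature.….GradientRG.WeightData` (ABKM19 Ch. 7: forms `A_k^X`,
`A_{k:k+1}^X`, Theorem 7.1 (w1)–(w9) from hypotheses `Dominated` / `Monotone` / `Local` /
`Additive` / `StrongDominated`) is to be instantiated for the line's model on `Λ = (ℤ/n)^4`.  This
file supplies the scale-`0` end and the finite-range mechanism:

* the DIRICHLET FORM ON `X`, `dirichletForm n X = ½ Σ_i ∇_iᵀ 1_X ∇_i` (`Theorems/…Defs`): its
  quadratic form `½ Σ_{x∈X}|∇φ(x)|²` (`dotProduct_dirichletForm_mulVec`), symmetry, positivity,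
  additivity over disjoint sets and monotonicity in `X` (the `seed_*` hypotheses of
  `WeightData.Dominated/Monotone/Additive/StrongDominated` for the gradient part of `A_0^X`),
  domination by `½(−Δ_Λ)` (`half_lapMat_sub_dirichletForm_posSemidef`), LOCALITY
  (`isGradLocal_dirichletForm`: it sees only gradients on bonds starting in `X`), and the
  identification of its exponential weight with the scale-`0` weight `e^{¼Q_X}` of
  `IsIotaAdmissible` / `tayNormLE_integral_pertActivity` (`expWeight_dirichletForm`);
* `circulant_separates` — a translation-invariant covariance whose kernel is CONSTANT on all
  differences `x − y`, `x ∈ S`, `y ∈ T` (clause (iii) of `GradientFRD.TorusFRD`: `𝒞_k(z) = M_k` for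
  `|z|_∞ ≥ L^k/2`) separates `S` from `T` in the sense of `Matrix.Separates` — the input
  `cov_separates` of `WeightData.Additive` (ABKM19 (7.58)).
-/

noncomputable section

-- `Summit.<Summit>.<Problem>`: single-conjunct summit, the duplicate component is mandated (D-0017).
set_option linter.dupNamespace false

namespace Summit.HubbardSuperconductivity.HubbardSuperconductivity.Theorems.ComplexGFF

open Finset Matrix
open Literature.MathematicalPhysics.StatisticalMechanics.ComplexGradientGFF4 (D)
open Literature.MathematicalPhysics.StatisticalMechanics.GradientRG (IsGradLocal expWeight)

variable {n : ℕ} [NeZero n]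

/-! ### §1 The Dirichlet form on `X` -/

/-- The quadratic form of one summand: `(φ, ∇_iᵀ 1_X ∇_i φ) = Σ_{x∈X} (∂_iφ(x))²`. -/
theorem dotProduct_gradT_ind_grad_mulVec (X : Finset (Fin 4 → ZMod n)) (i : Fin 4)
    (φ : (Fin 4 → ZMod n) → ℝ) :
    φ ⬝ᵥ ((gradMat n i).transpose * Matrix.diagonal (fun x => if x ∈ X then (1 : ℝ) else 0) *
        gradMat n i) *ᵥ φ = ∑ x ∈ X, (D φ i x) ^ 2 := by
  rw [← Matrix.mulVec_mulVec, ← Matrix.mulVec_mulVec, Matrix.dotProduct_mulVec,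
    Matrix.vecMul_transpose, gradMat_mulVec]
  simp only [dotProduct, Matrix.mulVec_diagonal]
  rw [← Finset.sum_filter_add_sum_filter_not Finset.univ (fun x => x ∈ X)]
  have h1 : ∑ x ∈ Finset.univ.filter (fun x => x ∈ X),
      D φ i x * ((if x ∈ X then (1 : ℝ) else 0) * D φ i x) = ∑ x ∈ X, (D φ i x) ^ 2 := by
    rw [Finset.filter_mem_eq_inter, Finset.univ_inter]
    exact Finset.sum_congr rfl fun x hx => by rw [if_pos hx, one_mul, sq]
  have h2 : ∑ x ∈ Finset.univ.filter (fun x => ¬ x ∈ X),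
      D φ i x * ((if x ∈ X then (1 : ℝ) else 0) * D φ i x) = 0 :=
    Finset.sum_eq_zero fun x hx => by
      rw [Finset.mem_filter] at hx
      rw [if_neg hx.2, zero_mul, mul_zero]
  rw [h1, h2, add_zero]

/-- **`(φ, dirichletForm n X φ) = ½ Σ_{x∈X} Σ_i (∂_iφ(x))²`.** -/
theorem dotProduct_dirichletForm_mulVec (X : Finset (Fin 4 → ZMod n))
    (φ : (Fin 4 → ZMod n) → ℝ) :
    φ ⬝ᵥ dirichletForm n X *ᵥ φ = (1/2 : ℝ) * ∑ x ∈ X, ∑ i : Fin 4, (D φ i x) ^ 2 := by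
  rw [dirichletForm, Matrix.smul_mulVec, dotProduct_smul, smul_eq_mul, Matrix.sum_mulVec,
    dotProduct_sum, Finset.sum_comm]
  congr 1
  exact Finset.sum_congr rfl fun i _ => dotProduct_gradT_ind_grad_mulVec X i φ

/-- `dirichletForm n X` is symmetric. -/
theorem isSymm_dirichletForm (X : Finset (Fin 4 → ZMod n)) : (dirichletForm n X).IsSymm := by
  unfold Matrix.IsSymm dirichletForm
  rw [Matrix.transpose_smul, Matrix.transpose_sum]
  congr 1
  refine Finset.sum_congr rfl fun i _ => ?_
  rw [Matrix.transpose_mul, Matrix.transpose_mul, Matrix.transpose_transpose, Matrix.diagonal_transpose,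
    Matrix.mul_assoc]

/-- `dirichletForm n X ⪰ 0`. -/
theorem posSemidef_dirichletForm (X : Finset (Fin 4 → ZMod n)) : (dirichletForm n X).PosSemidef := by
  refine Matrix.PosSemidef.of_dotProduct_mulVec_nonneg
    (isHermitian_iff_isSymm.2 (isSymm_dirichletForm X)) fun φ => ?_
  rw [star_trivial, dotProduct_dirichletForm_mulVec]
  exact mul_nonneg (by norm_num) (Finset.sum_nonneg fun _ _ => Finset.sum_nonneg fun _ _ => sq_nonneg _)

/-- **Additivity over disjoint sets**: `dirichletForm (X ∪ Y) = dirichletForm X + dirichletForm Y`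
(the seed is a sum over sites; ABKM19 (7.59) at `k = 0`). -/
theorem dirichletForm_union {X Y : Finset (Fin 4 → ZMod n)} (h : Disjoint X Y) :
    dirichletForm n (X ∪ Y) = dirichletForm n X + dirichletForm n Y := by
  have hdiag : Matrix.diagonal (fun x : Fin 4 → ZMod n => if x ∈ X ∪ Y then (1 : ℝ) else 0) =
      Matrix.diagonal (fun x => if x ∈ X then (1 : ℝ) else 0) +
        Matrix.diagonal (fun x => if x ∈ Y then (1 : ℝ) else 0) := by
    rw [Matrix.diagonal_add]
    congr 1
    funext x
    simp only [Finset.mem_union]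
    by_cases hX : x ∈ X
    · have hY : x ∉ Y := Finset.disjoint_left.1 h hX
      simp [hX, hY]
    · by_cases hY : x ∈ Y <;> simp [hX, hY]
  rw [dirichletForm, dirichletForm, dirichletForm, ← smul_add, ← Finset.sum_add_distrib]
  congr 1
  refine Finset.sum_congr rfl fun i _ => ?_
  rw [hdiag, Matrix.mul_add, Matrix.add_mul]

/-- **Monotonicity in `X`**: `dirichletForm X ⪯ dirichletForm Y` for `X ⊆ Y` (Lemma 7.5 (iv) at `k = 0`). -/
theorem dirichletForm_mono {X Y : Finset (Fin 4 → ZMod n)} (h : X ⊆ Y) :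
    (dirichletForm n Y - dirichletForm n X).PosSemidef := by
  have hY : Y = X ∪ (Y \ X) := by rw [Finset.union_sdiff_of_subset h]
  rw [hY, dirichletForm_union Finset.disjoint_sdiff, add_sub_cancel_left]
  exact posSemidef_dirichletForm _

/-- `dirichletForm n univ = ½ (−Δ_Λ)`. -/
theorem dirichletForm_univ : dirichletForm n Finset.univ = (1/2 : ℝ) • lapMat n := by
  rw [dirichletForm, lapMat]
  congr 1
  refine Finset.sum_congr rfl fun i _ => ?_
  have : (fun x : Fin 4 → ZMod n => if x ∈ (Finset.univ : Finset _) then (1 : ℝ) else 0) =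
      fun _ => 1 := funext fun x => if_pos (Finset.mem_univ x)
  rw [this, Matrix.diagonal_one, Matrix.mul_one]

/-- **`dirichletForm X ⪯ ½(−Δ_Λ)`**: the seed is dominated by half the Gaussian action
(`1 − 4θ̄ = ½` in ABKM19 (7.5); the source of subcriticality at scale `0`). -/
theorem half_lapMat_sub_dirichletForm_posSemidef (X : Finset (Fin 4 → ZMod n)) :
    ((1/2 : ℝ) • lapMat n - dirichletForm n X).PosSemidef := by
  rw [← dirichletForm_univ]
  exact dirichletForm_mono (Finset.subset_univ X)

/-- **Locality**: `dirichletForm n X` sees only the gradients on the bonds `(x, x + e_i)`, `x ∈ X`: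
if `S` contains `x` and `x + e_i` for every `x ∈ X` then `IsGradLocal (dirichletForm n X) S`
(Lemma 7.5 (iii) at `k = 0`: "`D_Ω(x)` can be expressed as a function of `∇φ` on `x + [0,R]^d`"). -/
theorem isGradLocal_dirichletForm {X S : Finset (Fin 4 → ZMod n)}
    (hS : ∀ x ∈ X, x ∈ S ∧ ∀ i : Fin 4, x + Pi.single i 1 ∈ S) :
    IsGradLocal (dirichletForm n X) S := by
  intro φ hφ
  have hD : ∀ x ∈ X, ∀ i : Fin 4, D φ i x = 0 := fun x hx i => by
    have h := hS x hx
    rw [D, hφ _ (h.2 i) _ h.1, sub_self]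
  have hterm : ∀ i : Fin 4, ((gradMat n i).transpose *
      Matrix.diagonal (fun x => if x ∈ X then (1 : ℝ) else 0) * gradMat n i) *ᵥ φ = 0 := by
    intro i
    rw [← Matrix.mulVec_mulVec, ← Matrix.mulVec_mulVec, gradMat_mulVec]
    have h0 : Matrix.diagonal (fun x => if x ∈ X then (1 : ℝ) else 0) *ᵥ (fun s => D φ i s) = 0 := by
      funext x
      rw [Matrix.mulVec_diagonal, Pi.zero_apply]
      by_cases hx : x ∈ X
      · rw [hD x hx i, mul_zero]
      · rw [if_neg hx, zero_mul]
    rw [h0, Matrix.mulVec_zero]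
  rw [dirichletForm, Matrix.smul_mulVec, Matrix.sum_mulVec, Finset.sum_eq_zero fun i _ => hterm i,
    smul_zero]

/-- In particular `dirichletForm n X` is local on every `S ⊇ X ∪ (X + e_i)` given as the forward
thickening `X⁺ = X ∪ ⋃_i (X + e_i)`. -/
theorem isGradLocal_dirichletForm_thickening (X : Finset (Fin 4 → ZMod n)) :
    IsGradLocal (dirichletForm n X)
      (X ∪ Finset.univ.biUnion fun i : Fin 4 => X.image fun x => x + Pi.single i 1) :=
  isGradLocal_dirichletForm fun _ hx =>
    ⟨Finset.mem_union_left _ hx, fun i => Finset.mem_union_right _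
      (Finset.mem_biUnion.2 ⟨i, Finset.mem_univ i, Finset.mem_image_of_mem _ hx⟩)⟩

/-- **The exponential weight of the Dirichlet form is the scale-`0` weight of the line**:
`expWeight (dirichletForm n X) φ = exp(¼ Σ_{x∈X} Σ_i (∂_iφ(x))²)` — the weight `w_X` of
`tayNormLE_integral_pertActivity` / `IsIotaAdmissible` (ABKM19 (12.13)). -/
theorem expWeight_dirichletForm (X : Finset (Fin 4 → ZMod n)) (φ : (Fin 4 → ZMod n) → ℝ) :
    expWeight (dirichletForm n X) φ = Real.exp ((∑ x ∈ X, ∑ i : Fin 4, (D φ i x) ^ 2) / 4) := by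
  rw [expWeight, dotProduct_dirichletForm_mulVec]
  congr 1
  ring

/-! ### §2 Finite range ⇒ separation (ABKM19 (7.58)) -/

omit [NeZero n] in
/-- **A kernel constant across `S − T` separates `S` from `T`.**  Let `𝒢 : Λ → ℝ` be a kernel on an
additive group `Λ` with `𝒢(x − y) = c₀` for all `x ∈ S`, `y ∈ T` (for the finite-range kernels of
`GradientFRD.TorusFRD`, clause (iii): `𝒢(z) = M_k` once `|z|_∞ ≥ L^k/2`, this holds whenever
`dist_∞(S, T) ≥ L^k/2`).  Then `circulant 𝒢` maps zero-sum fields supported in `T` to fields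
vanishing on `S`: `Matrix.Separates (circulant 𝒢) S T` (the input `cov_separates` of
`GradientRG.WeightData.Additive`). -/
theorem circulant_separates {Λ : Type*} [Fintype Λ] [DecidableEq Λ] [AddGroup Λ] {𝒢 : Λ → ℝ}
    {c₀ : ℝ} {S T : Finset Λ} (h : ∀ x ∈ S, ∀ y ∈ T, 𝒢 (x - y) = c₀) :
    (Matrix.circulant 𝒢).Separates S T := by
  intro v hv hsum
  refine ⟨0, fun x hx => ?_⟩
  have hterm : ∀ y, 𝒢 (x - y) * v y = c₀ * v y := fun y => by
    by_cases hy : y ∈ T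
    · rw [h x hx y hy]
    · rw [hv y hy, mul_zero, mul_zero]
  simp only [Matrix.mulVec, dotProduct, Matrix.circulant_apply, hterm, ← Finset.mul_sum, hsum,
    mul_zero]

/-- The torus instance: if `𝒢(z) = c₀` whenever `r ≤ |z|_∞` (`GradientFRD.supNorm`) and every pair
`x ∈ S`, `y ∈ T` has `r ≤ |x − y|_∞`, then `circulant 𝒢` separates `S` from `T`. -/
theorem circulant_separates_of_supNorm {d M : ℕ} [NeZero M] {𝒢 : (Fin d → ZMod M) → ℝ} {c₀ r : ℝ}
    (h𝒢 : ∀ z : Fin d → ZMod M,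
      r ≤ (Literature.MathematicalPhysics.StatisticalMechanics.GradientFRD.supNorm z : ℝ) → 𝒢 z = c₀)
    {S T : Finset (Fin d → ZMod M)}
    (hST : ∀ x ∈ S, ∀ y ∈ T,
      r ≤ (Literature.MathematicalPhysics.StatisticalMechanics.GradientFRD.supNorm (x - y) : ℝ)) :
    (Matrix.circulant 𝒢).Separates S T :=
  circulant_separates fun x hx y hy => h𝒢 _ (hST x hx y hy)

end Summit.HubbardSuperconductivity.HubbardSuperconductivity.Theorems.ComplexGFF

end
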